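import Summits.QuantumFields.YangMills.Theorems.BalabanUVNodesN15TwoSpacingGluingAdjointLocalGauges
import Summits.QuantumFields.YangMills.Theorems.BalabanUVNodesN15CurvedGluingLocalGaugesTwoGridFit
import HarnessLib

/-!
# THE ADJOINT GLUING ACROSS PER-CUBE GAUGES, TWO GRIDS WITH A GAUGE FIT (dag-n15-w2 `…CurvedGluingLocalGaugesTwoGridFit` transposed): FILE 158's two-spacing η-defect of entry 2 for the
# conjugated-back families under two UNRELATED per-cube gauges `u_k` (coarse), `u′_k` (fine) agreeing across the block map up to the displayed fit `o_W` — the situation of FILE 119∕124's cover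
# (dag-n15-c g18, FILE 164; N15 = NE2, s1 «background-layer OPERATOR ingredient»)

Cell `pub-ymgap`, seat `pub-ymgap-dag-n15-c` (R134 (a); HUMAN RULING D-0062), generation 18.  `bears_on: R4∕N15 · K3⁸ SpineGivenEndpointR13SepCoPHV (stmt-QuantumFields-27366)`.
Filed `--kind proof --supports stmt-QuantumFields-27366 --as helper` — COUNT-NEUTRAL.  Theorems only; 0 `def`, 0 `sorry`.  Imports BY NAME FILE 160 `…TwoSpacingGluingAdjointLocalGauges` (one-grid
transfers at both grids) and dag-n15-w2 `…CurvedGluingLocalGaugesTwoGridFit` (`cutDefect_of_localGauges`; through it dag-n15-w3 `hasMaj_idef_gaugeConj`, `comp_commOp_gaugeConj`, `localOp_conj_back`,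
`entry_le_one_of_orthogonal`, `transpose_entry_le_one_of_orthogonal`); FILE 158 `hasMaj_idef_glueInvL_parametrix_comp_cut_of_defect_out`.  Nothing restated.

WHY.  FILE 161 did the two-grid transfer in the PULLED-BACK fine gauge `u_k∘π`; the cover's fine cubes live in their OWN small-field gauges `u′_k` (FILE 124), which agree with `u_k∘π` only up to a fit
(dag-n15-w3 `hasMaj_idef_gaugeConj`: `𝔇(T′^{W′}, T^W) ≤ |κ|²K_𝔇 + |κ|(oK + K′o)`).  THIS FILE is the fitted edition: the adjoint-side defect families (OUTPUT-localized commutator defects, two-sided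
sandwiched-operator and right-locality defects) transfer with `|κ|²· + 2|κ|o_W·(row)`, then FILE 158 ★★★.

WHAT.  §1 `commDefectR_of_localGauges`, `conjDefect₂_of_localGauges`; §2 ★★★ `hasMaj_idef_gluedL_comp_of_localGauges_fit`.

HONEST FRAMING ∕ LIMITS.  Conjugation algebra + block-majorant bookkeeping over DISPLAYED letters at both grids; proves NO estimate of any concrete propagator; nothing of [B5]∕[B6]∕[B9] asserted
((3.34)–(3.35) p.396, (3.42) p.397, (3.87) p.409, (2.91)–(2.93) p.239, (2.133)–(2.136) p.247 = SHAPES; Thm 3.14 pp.426–427 = difference TEMPLATE).  NE2⁺ NOT PRINTED, NOT proved; N15 NOT discharged;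
K3⁸ OPEN, skeleton v7 untouched (0∕2); counts of record UNMOVED by this seat (typed 28∕28 · discharged 7∕28 = 7∕27 excl. NODE O, №245); one finite 𝕋⁴ at fixed ε — NOT infinite volume, NOT OS on ℝ⁴,
NOT a mass gap, NOT Clay; R4 closes the conditional finite-𝕋⁴ rung `BalabanLadder.UV` only.  Restate-immune (no Theses import).
-/

set_option autoImplicit false

noncomputable section
open scoped BigOperators Matrix
open Finset

namespace Summit.QuantumFields.YangMills.BalabanUVNodes.N15.Gluing

open Literature.MathematicalPhysics.QuantumFieldTheory.Balaban1983to89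
open Literature.MathematicalPhysics.QuantumFieldTheory.Balaban1983to89.B11SectG (BlockNorm HasMaj RowSum)
open Literature.MathematicalPhysics.QuantumFieldTheory.Balaban1983to89.B6RandomWalk (Triangle254)
open Literature.MathematicalPhysics.QuantumFieldTheory.Balaban1983to89.B6Prop26Gluing (mulOp ind ind_nonneg)
open Literature.MathematicalPhysics.QuantumFieldTheory.Balaban1983to89.T4EtaRateDefect (idef)
open Literature.MathematicalPhysics.QuantumFieldTheory.Balaban1983to89.T4EtaRateCoeffDefect (pull)
open Summit.QuantumFields.YangMills.BalabanUVNodes.N15.MatrixSpecies (mmulOp liftBlk liftMap)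
open Summit.QuantumFields.YangMills.BalabanUVNodes.N15.CurvedSpecies (cutRow_of_localGauge cutDefect_of_localGauges localOp_conj_back comp_commOp_gaugeConj hasMaj_idef_gaugeConj
  entry_le_one_of_orthogonal transpose_entry_le_one_of_orthogonal)

variable {X X' : Type} [Fintype X] [Fintype X'] [DecidableEq X] [DecidableEq X'] {κ : Type} [Fintype κ] [DecidableEq κ] {K : Type} [Fintype K] {g : B6.Geometry}
  (blk : X → g.Site) (π : X' → X) (S : K → Set g.Site) (W : K → X → Matrix κ κ ℝ) (W' : K → X' → Matrix κ κ ℝ)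
  (Δ E : (X × κ → ℝ) →ₗ[ℝ] (X × κ → ℝ)) (Δ' Ef : (X' × κ → ℝ) →ₗ[ℝ] (X' × κ → ℝ)) (hX χX hs : K → X → ℝ) (hX' χX' hs' : K → X' → ℝ)
  (G' T' E' : K → (X × κ → ℝ) →ₗ[ℝ] (X × κ → ℝ)) (G'' T'' E'' : K → (X' × κ → ℝ) →ₗ[ℝ] (X' × κ → ℝ))

/-! ## §1 The adjoint-side η-defect families transfer under two unrelated per-cube gauges with a fit -/

section Rows

omit [DecidableEq X] [DecidableEq X'] [Fintype K] in
/-- ★★ **ADJOINT COMMUTATOR DEFECTS TRANSFER WITH A GAUGE FIT**: local OUTPUT-localized rows `G′∘[Δ^W, M_h], G″∘[Δ′^{W′}, M_{h′}] ≤ 1_S(y)·θ₀`, local defect `r`, gauge fit `o_W` ⟹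
`𝔇((M_{W′ᵀ}G″M_{W′})∘[Δ′, M_{h′}], (M_{Wᵀ}G′M_W)∘[Δ, M_h]) ≤ 1_S(y)·(|κ|²r + 2|κ|o_Wθ₀)·e^{−δd}`. [cite: Balaban1984PropagatorsII, (2.93) p.239 (shape, transposed); Balaban1985BackgroundPropagators, (3.34) p.396, Thm 3.14 pp.426–427] -/
theorem commDefectR_of_localGauges (hW : ∀ k x, W k x * (W k x)ᵀ = 1) (hW' : ∀ k x, (W k x)ᵀ * W k x = 1) (hV : ∀ k x', W' k x' * (W' k x')ᵀ = 1) (hV' : ∀ k x', (W' k x')ᵀ * W' k x' = 1)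
    {θ₀ r oW δ : ℝ} (hθ : 0 ≤ θ₀) (hr : 0 ≤ r) (hoW : 0 ≤ oW) (k : K)
    (hfit : ∀ x' i, ∑ j, |(W' k x')ᵀ i j - (W k (π x'))ᵀ i j| ≤ oW) (hfit' : ∀ x' i, ∑ j, |W' k x' i j - W k (π x') i j| ≤ oW)
    (hK : HasMaj (BlockNorm.ofBlocks g (liftBlk blk κ)) (BlockNorm.ofBlocks g (liftBlk blk κ)) (G' k ∘ₗ commOp (mmulOp (W k) ∘ₗ Δ ∘ₗ mmulOp (fun x => (W k x)ᵀ)) (fun p : X × κ => hX k p.1)) (fun y y' => ind (S k) y * (θ₀ * Real.exp (-(δ * g.dist y y')))))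
    (hK' : HasMaj (BlockNorm.ofBlocks g (liftBlk (blk ∘ π) κ)) (BlockNorm.ofBlocks g (liftBlk (blk ∘ π) κ)) (G'' k ∘ₗ commOp (mmulOp (W' k) ∘ₗ Δ' ∘ₗ mmulOp (fun x' => (W' k x')ᵀ)) (fun p : X' × κ => hX' k p.1)) (fun y y' => ind (S k) y * (θ₀ * Real.exp (-(δ * g.dist y y')))))
    (hD : HasMaj (BlockNorm.ofBlocks g (liftBlk blk κ)) (BlockNorm.ofBlocks g (liftBlk (blk ∘ π) κ))
      (idef (pull (liftMap π κ)) (pull (liftMap π κ)) (G'' k ∘ₗ commOp (mmulOp (W' k) ∘ₗ Δ' ∘ₗ mmulOp (fun x' => (W' k x')ᵀ)) (fun p : X' × κ => hX' k p.1)) (G' k ∘ₗ commOp (mmulOp (W k) ∘ₗ Δ ∘ₗ mmulOp (fun x => (W k x)ᵀ)) (fun p : X × κ => hX k p.1))) (fun y y' => ind (S k) y * (r * Real.exp (-(δ * g.dist y y'))))) :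
    HasMaj (BlockNorm.ofBlocks g (liftBlk blk κ)) (BlockNorm.ofBlocks g (liftBlk (blk ∘ π) κ))
      (idef (pull (liftMap π κ)) (pull (liftMap π κ)) ((mmulOp (fun x' => (W' k x')ᵀ) ∘ₗ G'' k ∘ₗ mmulOp (W' k)) ∘ₗ commOp Δ' (fun p : X' × κ => hX' k p.1)) ((mmulOp (fun x => (W k x)ᵀ) ∘ₗ G' k ∘ₗ mmulOp (W k)) ∘ₗ commOp Δ (fun p : X × κ => hX k p.1)))
      (fun y y' => ind (S k) y * (((Fintype.card κ : ℝ) ^ 2 * r + 2 * (Fintype.card κ : ℝ) * oW * θ₀) * Real.exp (-(δ * g.dist y y')))) := by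
  have hU' : ∀ x, ((W k x)ᵀ)ᵀ * (W k x)ᵀ = 1 := fun x => by rw [Matrix.transpose_transpose]; exact hW k x
  have hU'' : ∀ x', ((W' k x')ᵀ)ᵀ * (W' k x')ᵀ = 1 := fun x' => by rw [Matrix.transpose_transpose]; exact hV k x'
  have e := comp_commOp_gaugeConj (fun x => (W k x)ᵀ) hU' (hX k) (mmulOp (W k) ∘ₗ Δ ∘ₗ mmulOp (fun x => (W k x)ᵀ)) (G' k)
  have e' := comp_commOp_gaugeConj (fun x' => (W' k x')ᵀ) hU'' (hX' k) (mmulOp (W' k) ∘ₗ Δ' ∘ₗ mmulOp (fun x' => (W' k x')ᵀ)) (G'' k)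
  simp only [Matrix.transpose_transpose] at e e'
  rw [show (fun x => W k x) = W k from rfl, localOp_conj_back W Δ hW' k] at e
  rw [show (fun x' => W' k x') = W' k from rfl, localOp_conj_back W' Δ' hV' k] at e'
  rw [e, e']
  have hK0 : ∀ y y', 0 ≤ ind (S k) y * (θ₀ * Real.exp (-(δ * g.dist y y'))) := fun y y' => mul_nonneg (ind_nonneg _ y) (mul_nonneg hθ (Real.exp_nonneg _))
  have h := hasMaj_idef_gaugeConj π (fun x => (W k x)ᵀ) (fun x' => (W' k x')ᵀ) blk (o := fun _ => oW) hK0 hK0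
    (fun y y' => mul_nonneg (ind_nonneg _ y) (mul_nonneg hr (Real.exp_nonneg _))) (fun _ => hoW)
    (fun x i j => by rw [Matrix.transpose_transpose]; exact entry_le_one_of_orthogonal (hW k) x i j) (transpose_entry_le_one_of_orthogonal (hV' k))
    (fun x' i => hfit x' i) (fun x' i => by simpa only [Matrix.transpose_transpose] using hfit' x' i) hK hK' hD
  simp only [Matrix.transpose_transpose] at h
  rw [show (fun x => W k x) = W k from rfl, show (fun x' => W' k x') = W' k from rfl] at h
  exact h.mono fun y y' => le_of_eq (by ring)

omit [DecidableEq X] [DecidableEq X'] [Fintype K] in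
/-- ★ **TWO-SIDED DEFECTS TRANSFER WITH A GAUGE FIT** (sandwiched operators, right-locality defects): local two-sided rows `β` on both grids, local defect `m`, gauge fit `o_W` ⟹
`𝔇(M_{W′ᵀ}T₂M_{W′}, M_{Wᵀ}T₁M_W) ≤ 1_S1_S·(|κ|²m + 2|κ|o_Wβ)·e^{−δd}`. [cite: Balaban1985BackgroundPropagators, (3.34)–(3.35) p.396, Thm 3.14 pp.426–427 (shapes)] -/
theorem conjDefect₂_of_localGauges (hW : ∀ k x, W k x * (W k x)ᵀ = 1) (hV' : ∀ k x', (W' k x')ᵀ * W' k x' = 1) {β m oW δ : ℝ} (hβ : 0 ≤ β) (hm : 0 ≤ m) (hoW : 0 ≤ oW) (k : K)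
    {T₁ : K → (X × κ → ℝ) →ₗ[ℝ] (X × κ → ℝ)} {T₂ : K → (X' × κ → ℝ) →ₗ[ℝ] (X' × κ → ℝ)}
    (hfit : ∀ x' i, ∑ j, |(W' k x')ᵀ i j - (W k (π x'))ᵀ i j| ≤ oW) (hfit' : ∀ x' i, ∑ j, |W' k x' i j - W k (π x') i j| ≤ oW)
    (h₁ : HasMaj (BlockNorm.ofBlocks g (liftBlk blk κ)) (BlockNorm.ofBlocks g (liftBlk blk κ)) (T₁ k) (fun y y' => ind (S k) y * ind (S k) y' * (β * Real.exp (-(δ * g.dist y y'))))) (h₂ : HasMaj (BlockNorm.ofBlocks g (liftBlk (blk ∘ π) κ)) (BlockNorm.ofBlocks g (liftBlk (blk ∘ π) κ)) (T₂ k) (fun y y' => ind (S k) y * ind (S k) y' * (β * Real.exp (-(δ * g.dist y y')))))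
    (hD : HasMaj (BlockNorm.ofBlocks g (liftBlk blk κ)) (BlockNorm.ofBlocks g (liftBlk (blk ∘ π) κ)) (idef (pull (liftMap π κ)) (pull (liftMap π κ)) (T₂ k) (T₁ k)) (fun y y' => ind (S k) y * ind (S k) y' * (m * Real.exp (-(δ * g.dist y y'))))) :
    HasMaj (BlockNorm.ofBlocks g (liftBlk blk κ)) (BlockNorm.ofBlocks g (liftBlk (blk ∘ π) κ))
      (idef (pull (liftMap π κ)) (pull (liftMap π κ)) (mmulOp (fun x' => (W' k x')ᵀ) ∘ₗ T₂ k ∘ₗ mmulOp (W' k)) (mmulOp (fun x => (W k x)ᵀ) ∘ₗ T₁ k ∘ₗ mmulOp (W k)))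
      (fun y y' => ind (S k) y * ind (S k) y' * (((Fintype.card κ : ℝ) ^ 2 * m + 2 * (Fintype.card κ : ℝ) * oW * β) * Real.exp (-(δ * g.dist y y')))) := by
  have hK0 : ∀ y y', 0 ≤ ind (S k) y * ind (S k) y' * (β * Real.exp (-(δ * g.dist y y'))) := fun y y' =>
    mul_nonneg (mul_nonneg (ind_nonneg _ y) (ind_nonneg _ y')) (mul_nonneg hβ (Real.exp_nonneg _))
  have h := hasMaj_idef_gaugeConj π (fun x => (W k x)ᵀ) (fun x' => (W' k x')ᵀ) blk (o := fun _ => oW) hK0 hK0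
    (fun y y' => mul_nonneg (mul_nonneg (ind_nonneg _ y) (ind_nonneg _ y')) (mul_nonneg hm (Real.exp_nonneg _))) (fun _ => hoW)
    (fun x i j => by rw [Matrix.transpose_transpose]; exact entry_le_one_of_orthogonal (hW k) x i j) (transpose_entry_le_one_of_orthogonal (hV' k))
    (fun x' i => hfit x' i) (fun x' i => by simpa only [Matrix.transpose_transpose] using hfit' x' i) h₁ h₂ hD
  simp only [Matrix.transpose_transpose] at h
  rw [show (fun x => W k x) = W k from rfl, show (fun x' => W' k x') = W' k from rfl] at h
  exact h.mono fun y y' => le_of_eq (by ring)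

end Rows

/-! ## §2 FILE 158's two-spacing η-defect with the cubes in unrelated per-cube gauges -/

section Glue

variable {σ cr : ℝ}

/-- ★★★ **THE TWO-SPACING η-DEFECT OF ENTRY 2 OF THE ADJOINT GLUED OPERATOR, CUBES IN UNRELATED PER-CUBE GAUGES WITH A FIT** — FILE 158 `hasMaj_idef_glueInvL_parametrix_comp_cut_of_defect_out`
for the conjugated-back families (coarse gauges `W_k`, fine gauges `W′_k`, fit `o_W` both ways), every per-cube datum IN THE CUBES' GAUGES at both grids (as FILE 161) ⟹ FILE 158 ★★★'s bound with
the cube letters `β, β₂, θ₀, ε ↦ |κ|²·` and the defect letters `m₀ ↦ |κ|²m₀ + 2|κ|o_Wβ`, `m₂ ↦ |κ|²m₂ + 2|κ|o_Wβ₂`, `r ↦ |κ|²r + 2|κ|o_Wθ₀`, `r_E ↦ |κ|²r_E + 2|κ|o_Wε`.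
[cite: Balaban1985BackgroundPropagators, Thm 3.14 pp.426–427 (difference template), (3.34)–(3.35) p.396, (3.42) p.397, (3.87) p.409; Balaban1984PropagatorsII, (2.91)–(2.93) p.239, (2.133)–(2.136) p.247] -/
theorem hasMaj_idef_gluedL_comp_of_localGauges_fit (htri : Triangle254 g) (hd : ∀ a b : g.Site, 0 ≤ g.dist a b) (hd0 : ∀ y : g.Site, g.dist y y = 0) (hrow : RowSum g σ cr) (hσ : 0 ≤ σ)
    (hcr : 0 ≤ cr) (hW : ∀ k x, W k x * (W k x)ᵀ = 1) (hW' : ∀ k x, (W k x)ᵀ * W k x = 1) (hV : ∀ k x', W' k x' * (W' k x')ᵀ = 1) (hV' : ∀ k x', (W' k x')ᵀ * W' k x' = 1)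
    {dh : K → X → ℝ} {dh' : K → X' → ℝ}
    {β β₂ cs cd o os od m₀ m₂ θ₀ ε r rE oW δ Nov : ℝ} (hβ : 0 ≤ β) (hβ₂ : 0 ≤ β₂) (hcs : 0 ≤ cs) (hcd : 0 ≤ cd) (ho : 0 ≤ o) (hos : 0 ≤ os) (hod : 0 ≤ od) (hm₀ : 0 ≤ m₀) (hm₂ : 0 ≤ m₂)
    (hθ : 0 ≤ θ₀) (hε : 0 ≤ ε) (hr : 0 ≤ r) (hrE : 0 ≤ rE) (hoW : 0 ≤ oW) (hNov : 0 ≤ Nov) (hσδ : 2 * σ ≤ δ)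
    (hfitW : ∀ k x' i, ∑ j, |(W' k x')ᵀ i j - (W k (π x'))ᵀ i j| ≤ oW) (hfitW' : ∀ k x' i, ∑ j, |W' k x' i j - W k (π x') i j| ≤ oW)
    (hleib : ∀ k, mulOp (fun p : X × κ => hX k p.1) ∘ₗ E = E ∘ₗ mulOp (fun p : X × κ => hs k p.1) + mulOp (fun p : X × κ => dh k p.1))
    (hleib' : ∀ k, mulOp (fun p : X' × κ => hX' k p.1) ∘ₗ Ef = Ef ∘ₗ mulOp (fun p : X' × κ => hs' k p.1) + mulOp (fun p : X' × κ => dh' k p.1))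
    (hcut : ∀ k, mulOp (fun p : X × κ => hX k p.1) ∘ₗ mulOp (fun p : X × κ => χX k p.1) = mulOp (fun p : X × κ => hX k p.1))
    (hcut' : ∀ k, mulOp (fun p : X' × κ => hX' k p.1) ∘ₗ mulOp (fun p : X' × κ => χX' k p.1) = mulOp (fun p : X' × κ => hX' k p.1))
    (hE2' : ∀ k, mulOp (fun p : X × κ => χX k p.1) ∘ₗ G' k ∘ₗ (mmulOp (W k) ∘ₗ E ∘ₗ mmulOp (fun x => (W k x)ᵀ)) ∘ₗ mulOp (fun p : X × κ => hs k p.1) = T' k ∘ₗ mulOp (fun p : X × κ => hs k p.1))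
    (hE2'' : ∀ k, mulOp (fun p : X' × κ => χX' k p.1) ∘ₗ G'' k ∘ₗ (mmulOp (W' k) ∘ₗ Ef ∘ₗ mmulOp (fun x' => (W' k x')ᵀ)) ∘ₗ mulOp (fun p : X' × κ => hs' k p.1) = T'' k ∘ₗ mulOp (fun p : X' × κ => hs' k p.1))
    (hh : ∀ k x, |hX k x| ≤ 1) (hh' : ∀ k x', |hX' k x'| ≤ 1) (hhs : ∀ k x, |hs k x| ≤ cs) (hdh : ∀ k x, |dh k x| ≤ cd)
    (hfit : ∀ k x', |hX' k x' - hX k (π x')| ≤ o) (hfits : ∀ k x', |hs' k x' - hs k (π x')| ≤ os) (hfitd : ∀ k x', |dh' k x' - dh k (π x')| ≤ od) (hN : ∀ b, ∑ k, ind (S k) b ≤ Nov)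
    (hGc' : ∀ k, HasMaj (BlockNorm.ofBlocks g (liftBlk blk κ)) (BlockNorm.ofBlocks g (liftBlk blk κ)) (mulOp (fun p : X × κ => χX k p.1) ∘ₗ G' k) (fun y y' => ind (S k) y * ind (S k) y' * (β * Real.exp (-(δ * g.dist y y')))))
    (hGc'' : ∀ k, HasMaj (BlockNorm.ofBlocks g (liftBlk (blk ∘ π) κ)) (BlockNorm.ofBlocks g (liftBlk (blk ∘ π) κ)) (mulOp (fun p : X' × κ => χX' k p.1) ∘ₗ G'' k) (fun y y' => ind (S k) y * ind (S k) y' * (β * Real.exp (-(δ * g.dist y y')))))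
    (hT' : ∀ k, HasMaj (BlockNorm.ofBlocks g (liftBlk blk κ)) (BlockNorm.ofBlocks g (liftBlk blk κ)) (T' k) (fun y y' => ind (S k) y * ind (S k) y' * (β₂ * Real.exp (-(δ * g.dist y y')))))
    (hT'' : ∀ k, HasMaj (BlockNorm.ofBlocks g (liftBlk (blk ∘ π) κ)) (BlockNorm.ofBlocks g (liftBlk (blk ∘ π) κ)) (T'' k) (fun y y' => ind (S k) y * ind (S k) y' * (β₂ * Real.exp (-(δ * g.dist y y')))))
    (hIGc : ∀ k, HasMaj (BlockNorm.ofBlocks g (liftBlk blk κ)) (BlockNorm.ofBlocks g (liftBlk (blk ∘ π) κ)) (idef (pull (liftMap π κ)) (pull (liftMap π κ)) (mulOp (fun p : X' × κ => χX' k p.1) ∘ₗ G'' k) (mulOp (fun p : X × κ => χX k p.1) ∘ₗ G' k)) (fun y y' => ind (S k) y * ind (S k) y' * (m₀ * Real.exp (-(δ * g.dist y y')))))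
    (hIT : ∀ k, HasMaj (BlockNorm.ofBlocks g (liftBlk blk κ)) (BlockNorm.ofBlocks g (liftBlk (blk ∘ π) κ)) (idef (pull (liftMap π κ)) (pull (liftMap π κ)) (T'' k) (T' k)) (fun y y' => ind (S k) y * ind (S k) y' * (m₂ * Real.exp (-(δ * g.dist y y')))))
    (hK' : ∀ k, HasMaj (BlockNorm.ofBlocks g (liftBlk blk κ)) (BlockNorm.ofBlocks g (liftBlk blk κ)) (G' k ∘ₗ commOp (mmulOp (W k) ∘ₗ Δ ∘ₗ mmulOp (fun x => (W k x)ᵀ)) (fun p : X × κ => hX k p.1)) (fun y y' => ind (S k) y * (θ₀ * Real.exp (-(δ * g.dist y y')))))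
    (hK'' : ∀ k, HasMaj (BlockNorm.ofBlocks g (liftBlk (blk ∘ π) κ)) (BlockNorm.ofBlocks g (liftBlk (blk ∘ π) κ)) (G'' k ∘ₗ commOp (mmulOp (W' k) ∘ₗ Δ' ∘ₗ mmulOp (fun x' => (W' k x')ᵀ)) (fun p : X' × κ => hX' k p.1)) (fun y y' => ind (S k) y * (θ₀ * Real.exp (-(δ * g.dist y y')))))
    (hDK : ∀ k, HasMaj (BlockNorm.ofBlocks g (liftBlk blk κ)) (BlockNorm.ofBlocks g (liftBlk (blk ∘ π) κ))
      (idef (pull (liftMap π κ)) (pull (liftMap π κ)) (G'' k ∘ₗ commOp (mmulOp (W' k) ∘ₗ Δ' ∘ₗ mmulOp (fun x' => (W' k x')ᵀ)) (fun p : X' × κ => hX' k p.1)) (G' k ∘ₗ commOp (mmulOp (W k) ∘ₗ Δ ∘ₗ mmulOp (fun x => (W k x)ᵀ)) (fun p : X × κ => hX k p.1))) (fun y y' => ind (S k) y * (r * Real.exp (-(δ * g.dist y y')))))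
    (hEd' : ∀ k, HasMaj (BlockNorm.ofBlocks g (liftBlk blk κ)) (BlockNorm.ofBlocks g (liftBlk blk κ)) (E' k) (fun y y' => ind (S k) y * ind (S k) y' * (ε * Real.exp (-(δ * g.dist y y')))))
    (hEd'' : ∀ k, HasMaj (BlockNorm.ofBlocks g (liftBlk (blk ∘ π) κ)) (BlockNorm.ofBlocks g (liftBlk (blk ∘ π) κ)) (E'' k) (fun y y' => ind (S k) y * ind (S k) y' * (ε * Real.exp (-(δ * g.dist y y')))))
    (hDEd : ∀ k, HasMaj (BlockNorm.ofBlocks g (liftBlk blk κ)) (BlockNorm.ofBlocks g (liftBlk (blk ∘ π) κ)) (idef (pull (liftMap π κ)) (pull (liftMap π κ)) (E'' k) (E' k)) (fun y y' => ind (S k) y * ind (S k) y' * (rE * Real.exp (-(δ * g.dist y y')))))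
    (hq : Nov * ((Fintype.card κ : ℝ) ^ 2 * θ₀ + (Fintype.card κ : ℝ) ^ 2 * ε) * cr < 1) :
    HasMaj (BlockNorm.ofBlocks g (liftBlk blk κ)) (BlockNorm.ofBlocks g (liftBlk (blk ∘ π) κ))
      (idef (pull (liftMap π κ)) (pull (liftMap π κ))
        (glueInvL (remainderL Δ' (fun k => fun p : X' × κ => hX' k p.1) (fun k => (mmulOp (fun x' => (W' k x')ᵀ) ∘ₗ G'' k ∘ₗ mmulOp (W' k))) - ∑ k, mulOp (fun p : X' × κ => hX' k p.1) ∘ₗ (mmulOp (fun x' => (W' k x')ᵀ) ∘ₗ E'' k ∘ₗ mmulOp (W' k)))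
          (parametrix (fun k => fun p : X' × κ => hX' k p.1) (fun k => (mmulOp (fun x' => (W' k x')ᵀ) ∘ₗ G'' k ∘ₗ mmulOp (W' k)))) ∘ₗ Ef)
        (glueInvL (remainderL Δ (fun k => fun p : X × κ => hX k p.1) (fun k => (mmulOp (fun x => (W k x)ᵀ) ∘ₗ G' k ∘ₗ mmulOp (W k))) - ∑ k, mulOp (fun p : X × κ => hX k p.1) ∘ₗ (mmulOp (fun x => (W k x)ᵀ) ∘ₗ E' k ∘ₗ mmulOp (W k)))
          (parametrix (fun k => fun p : X × κ => hX k p.1) (fun k => (mmulOp (fun x => (W k x)ᵀ) ∘ₗ G' k ∘ₗ mmulOp (W k)))) ∘ₗ E))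
      (fun y y' => (((1 - Nov * (((Fintype.card κ : ℝ) ^ 2 * θ₀) + ((Fintype.card κ : ℝ) ^ 2 * ε)) * cr)⁻¹ * (Nov * ((1 * ((Fintype.card κ : ℝ) ^ 2 * β₂) * os + 1 * ((Fintype.card κ : ℝ) ^ 2 * m₂ + 2 * (Fintype.card κ : ℝ) * oW * β₂) * cs + o * ((Fintype.card κ : ℝ) ^ 2 * β₂) * cs) + (1 * ((Fintype.card κ : ℝ) ^ 2 * β) * od + 1 * ((Fintype.card κ : ℝ) ^ 2 * m₀ + 2 * (Fintype.card κ : ℝ) * oW * β) * cd + o * ((Fintype.card κ : ℝ) ^ 2 * β) * cd))) * cr +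
          (1 - Nov * (((Fintype.card κ : ℝ) ^ 2 * θ₀) + ((Fintype.card κ : ℝ) ^ 2 * ε)) * cr)⁻¹ * ((Nov * (((Fintype.card κ : ℝ) ^ 2 * r + 2 * (Fintype.card κ : ℝ) * oW * θ₀) + o * ((Fintype.card κ : ℝ) ^ 2 * θ₀) + (1 * ((Fintype.card κ : ℝ) ^ 2 * rE + 2 * (Fintype.card κ : ℝ) * oW * ε) + o * ((Fintype.card κ : ℝ) ^ 2 * ε)))) * ((1 - Nov * (((Fintype.card κ : ℝ) ^ 2 * θ₀) + ((Fintype.card κ : ℝ) ^ 2 * ε)) * cr)⁻¹ * (Nov * (((Fintype.card κ : ℝ) ^ 2 * β₂) * cs + ((Fintype.card κ : ℝ) ^ 2 * β) * cd)) * cr) * cr) * cr)) *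
        Real.exp (-((δ - 2 * σ) * g.dist y y'))) := by
  have hK1 : 0 ≤ (Fintype.card κ : ℝ) := Nat.cast_nonneg _
  exact hasMaj_idef_glueInvL_parametrix_comp_cut_of_defect_out (liftBlk blk κ) (liftMap π κ) S htri hd hd0 hrow hσ hcr (by positivity) (by positivity) hcs hcd ho hos hod (by positivity)
    (by positivity) (by positivity) (by positivity) (by positivity) (by positivity) hNov hσδ hleib hleib' hcut hcut'
    (fun k => sandwichR_of_localGauge W E χX hs G' T' hW' k (hE2' k))
    (fun k => sandwichR_of_localGauge W' Ef χX' hs' G'' T'' hV' k (hE2'' k))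
    (fun k p => hh k p.1) (fun k p => hh' k p.1) (fun k p => hhs k p.1) (fun k p => hdh k p.1) (fun k p => hfit k p.1) (fun k p => hfits k p.1) (fun k p => hfitd k p.1) hN
    (fun k => cutRow_of_localGauge blk S W χX G' hW hW' hβ k (hGc' k)) (fun k => cutRow_of_localGauge (blk ∘ π) S W' χX' G'' hV hV' hβ k (hGc'' k))
    (fun k => sandwichRow_of_localGauge blk S W T' hW hW' hβ₂ k (hT' k)) (fun k => sandwichRow_of_localGauge (blk ∘ π) S W' T'' hV hV' hβ₂ k (hT'' k))
    (fun k => cutDefect_of_localGauges blk π S W W' χX χX' G' G'' hW hV' hβ hm₀ hoW k (hfitW k) (hfitW' k) (hGc' k) (hGc'' k) (hIGc k))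
    (fun k => conjDefect₂_of_localGauges blk π S W W' hW hV' hβ₂ hm₂ hoW k (hfitW k) (hfitW' k) (hT' k) (hT'' k) (hIT k))
    (fun k => commRowR_of_localGauge blk S W Δ hX G' hW hW' hθ k (hK' k)) (fun k => commRowR_of_localGauge (blk ∘ π) S W' Δ' hX' G'' hV hV' hθ k (hK'' k))
    (fun k => commDefectR_of_localGauges blk π S W W' Δ Δ' hX hX' G' G'' hW hW' hV hV' hθ hr hoW k (hfitW k) (hfitW' k) (hK' k) (hK'' k) (hDK k))
    (fun k => defectRow₂_of_localGauge blk S W E' hW hW' hε k (hEd' k)) (fun k => defectRow₂_of_localGauge (blk ∘ π) S W' E'' hV hV' hε k (hEd'' k))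
    (fun k => conjDefect₂_of_localGauges blk π S W W' hW hV' hε hrE hoW k (hfitW k) (hfitW' k) (hEd' k) (hEd'' k) (hDEd k)) hq

end Glue

end Summit.QuantumFields.YangMills.BalabanUVNodes.N15.Gluing

end
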